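import Summits.CriticalPhenomena.PercolationContinuityZ3.Theorems.PercNearOneGluingNoHeavyLowerTailThreePartitionOneOr
import HarnessLib.Audit

/-!
# `NoHeavyLowerTail` (crux stmt-CriticalPhenomena-4575), master-family hierarchy P3 (gen 37): the ONE-DISJUNCTION THEOREM —
# `threePartNT τ (orFam Q) A B ≥ 0` for ALL up-sets `A, B` and EVERY twist `τ`

Support file (seat `prim-masterthm-p3`; `--supports stmt-CriticalPhenomena-4575`; memo
`run/shared/lean/prim/prim-masterthm/FROM-prim-masterthm-p3-g37-ONE-DISJUNCTION.md` §3).  The untwisted-`Q` case `τ ∩ Q = ∅` is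
`threePartNT_orFam_nonneg_of_disjoint` (`…ThreePartitionOneOr`).  Here: the case `τ ∩ Q ≠ ∅`, where the argument is much softer —
every pattern weight `c(P) = [qc₂ P ≠ ∅] + [qc₃ P ≠ ∅] − [qc₁ P ≠ ∅]` is NONNEGATIVE (an element of `τ ∩ Q` lies in two of the three twisted
Q-parts), so Kleitman applies termwise, `R = Σ_P c(P)·teeRep(qc₂P, qc₃P) ≤ Σ_P c(P)·deeRep₂(qc₂P, qc₃P)`, and the remaining pointwise
inequality on signatures of `2^Q`,
  `(BASE)  Σ_P c(P)·[qc₂P ∈ 𝔄][qc₃P ∈ 𝔅] ≤ Σ_P (2[qc₃P ≠ ∅] − [qc₁P ≠ ∅])·[qc₃P ∈ 𝔄 ∩ 𝔅]`   (𝔄, 𝔅 up-sets),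
is the theorem itself for JUNTA families `{x : x ∩ Q ∈ 𝔄}`; for juntas it follows from the NESTED class: with `𝒟 = (orFam Q)ᶜ`,
`N(orFam Q) = N(⊤) − N(𝒟)`, `N(⊤; 𝔄', 𝔅') ≥ 0` (`threePartNT_nonneg_of_nested`) and `N(𝒟; 𝔄', 𝔅') ≤ 0` because `𝒟 ∩ 𝔄' ∩ 𝔅' = ∅`
unless `∅ ∈ 𝔄 ∩ 𝔅` (then `𝔄' = 𝔅' = ⊤`).  Main results: `threePartNT_orFam_nonneg` (all twists), `threePartNT_nonneg_of_or` (any slot).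
HONEST LABEL: COMB-C3 / twisted three-partition positivity for ONE disjunction against two ARBITRARY increasing events, all profiles;
the general conjecture (three arbitrary increasing events) stays OPEN; nothing bears on the (closed) crux. [this work]
-/

noncomputable section

open Finset
open scoped symmDiff Classical

namespace Summit.CriticalPhenomena.PercolationContinuityZ3.Theorems.ThreePartition

variable {ι : Type*} [Fintype ι]

/-! ## Generalities: splitting a count along `𝒰 / 𝒰ᶜ`, and the sign of `N` on a first family missing `A ∩ B` -/

/-- A twisted count of an exclusive disjunction splits. [this work] -/
theorem triT_or_excl (τ : Set ι) {p q r : Set ι → Set ι → Set ι → Prop} (hr : ∀ a b c, r a b c ↔ p a b c ∨ q a b c)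
    (hpq : ∀ a b c, ¬ (p a b c ∧ q a b c)) : (triT τ r : ℤ) = triT τ p + triT τ q := by
  rw [triT_eq_sum_indZ, triT_eq_sum_indZ, triT_eq_sum_indZ, ← sum_add_distrib]
  refine sum_congr rfl fun s _ => ?_
  unfold indZ
  by_cases hD : Disjoint s.1 s.2
  · by_cases hp : p (s.1 ∆ τ) (s.2 ∆ τ) ((s.1 ∪ s.2)ᶜ ∆ τ)
    · have hq : ¬ q (s.1 ∆ τ) (s.2 ∆ τ) ((s.1 ∪ s.2)ᶜ ∆ τ) := fun h => hpq _ _ _ ⟨hp, h⟩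
      rw [if_pos ⟨hD, (hr _ _ _).2 (Or.inl hp)⟩, if_pos ⟨hD, hp⟩, if_neg fun h => hq h.2]; rfl
    · by_cases hq : q (s.1 ∆ τ) (s.2 ∆ τ) ((s.1 ∪ s.2)ᶜ ∆ τ)
      · rw [if_pos ⟨hD, (hr _ _ _).2 (Or.inr hq)⟩, if_neg fun h => hp h.2, if_pos ⟨hD, hq⟩]; rfl
      · rw [if_neg fun h => ((hr _ _ _).1 h.2).elim hp hq, if_neg fun h => hp h.2, if_neg fun h => hq h.2]; rfl
  · rw [if_neg fun h => hD h.1, if_neg fun h => hD h.1, if_neg fun h => hD h.1]; rfl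

/-- **Additivity of `N` in the first slot along a family and its complement**: `N(⊤; A, B) = N(𝒰; A, B) + N(𝒰ᶜ; A, B)`. [this work] -/
theorem threePartNT_univ_eq_add_compl (τ : Set ι) (𝒰 A B : Set (Set ι)) :
    threePartNT τ Set.univ A B = threePartNT τ 𝒰 A B + threePartNT τ 𝒰ᶜ A B := by
  rw [threePartNT_eq_phiPart_sub_rPart, threePartNT_eq_phiPart_sub_rPart, threePartNT_eq_phiPart_sub_rPart]
  unfold phiPart rPart
  rw [triT_or_excl τ (r := fun _ _ x₃ => x₃ ∈ (Set.univ : Set (Set ι)) ∧ x₃ ∈ A ∧ x₃ ∈ B) (p := fun _ _ x₃ => x₃ ∈ 𝒰 ∧ x₃ ∈ A ∧ x₃ ∈ B)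
      (q := fun _ _ x₃ => x₃ ∈ 𝒰ᶜ ∧ x₃ ∈ A ∧ x₃ ∈ B) (fun a b c => by simp only [Set.mem_univ, Set.mem_compl_iff, true_and]; tauto)
      (fun a b c => by simp only [Set.mem_compl_iff]; tauto),
    triT_or_excl τ (r := fun x₁ _ x₃ => x₁ ∈ (Set.univ : Set (Set ι)) ∧ x₃ ∈ A ∧ x₃ ∈ B) (p := fun x₁ _ x₃ => x₁ ∈ 𝒰 ∧ x₃ ∈ A ∧ x₃ ∈ B)
      (q := fun x₁ _ x₃ => x₁ ∈ 𝒰ᶜ ∧ x₃ ∈ A ∧ x₃ ∈ B) (fun a b c => by simp only [Set.mem_univ, Set.mem_compl_iff, true_and]; tauto)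
      (fun a b c => by simp only [Set.mem_compl_iff]; tauto),
    triT_or_excl τ (r := fun _ x₂ x₃ => x₂ ∈ A ∧ x₃ ∈ B ∧ x₃ ∈ (Set.univ : Set (Set ι))) (p := fun _ x₂ x₃ => x₂ ∈ A ∧ x₃ ∈ B ∧ x₃ ∈ 𝒰)
      (q := fun _ x₂ x₃ => x₂ ∈ A ∧ x₃ ∈ B ∧ x₃ ∈ 𝒰ᶜ) (fun a b c => by simp only [Set.mem_univ, Set.mem_compl_iff, and_true]; tauto)
      (fun a b c => by simp only [Set.mem_compl_iff]; tauto),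
    triT_or_excl τ (r := fun _ x₂ x₃ => x₂ ∈ A ∧ x₃ ∈ B ∧ x₂ ∈ (Set.univ : Set (Set ι))) (p := fun _ x₂ x₃ => x₂ ∈ A ∧ x₃ ∈ B ∧ x₂ ∈ 𝒰)
      (q := fun _ x₂ x₃ => x₂ ∈ A ∧ x₃ ∈ B ∧ x₂ ∈ 𝒰ᶜ) (fun a b c => by simp only [Set.mem_univ, Set.mem_compl_iff, and_true]; tauto)
      (fun a b c => by simp only [Set.mem_compl_iff]; tauto),
    triT_or_excl τ (r := fun x₁ x₂ x₃ => x₂ ∈ A ∧ x₃ ∈ B ∧ x₁ ∈ (Set.univ : Set (Set ι))) (p := fun x₁ x₂ x₃ => x₂ ∈ A ∧ x₃ ∈ B ∧ x₁ ∈ 𝒰)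
      (q := fun x₁ x₂ x₃ => x₂ ∈ A ∧ x₃ ∈ B ∧ x₁ ∈ 𝒰ᶜ) (fun a b c => by simp only [Set.mem_univ, Set.mem_compl_iff, and_true]; tauto)
      (fun a b c => by simp only [Set.mem_compl_iff]; tauto)]
  ring

/-- **`N(𝒟; A, B) ≤ 0` whenever `𝒟` misses `A ∩ B`** (any family `𝒟`, up-sets `A, B`): then `Φ = −dee(𝒟, A∩B)` and
`−R ≤ tee(𝒟, A, B) ≤ dee(𝒟, A ∩ B)` by Kleitman. [this work] -/
theorem threePartNT_nonpos_of_missing (τ : Set ι) (𝒟 : Set (Set ι)) {A B : Set (Set ι)} (hA : IsUpperSet A) (hB : IsUpperSet B)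
    (hd : ∀ x ∈ 𝒟, ¬ (x ∈ A ∧ x ∈ B)) : threePartNT τ 𝒟 A B ≤ 0 := by
  rw [threePartNT_eq_phiPart_sub_rPart]
  unfold phiPart rPart
  have h0 : (triT τ (fun _ _ x₃ => x₃ ∈ 𝒟 ∧ x₃ ∈ A ∧ x₃ ∈ B) : ℤ) = 0 := by
    rw [triT_eq_sum_indZ]; exact sum_eq_zero fun q _ => indZ_of_neg fun h => hd _ h.2.1 h.2.2
  have hK : (triT τ (fun x₁ x₂ x₃ => x₂ ∈ A ∧ x₃ ∈ B ∧ x₁ ∈ 𝒟) : ℤ) ≤ triT τ (fun x₁ _ x₃ => x₁ ∈ 𝒟 ∧ x₃ ∈ A ∧ x₃ ∈ B) := by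
    have h := teeT_le_deeT τ 𝒟 hA hB
    unfold teeT deeT at h
    rw [triT_congr (q := fun x₁ x₂ x₃ => x₂ ∈ A ∧ x₃ ∈ B ∧ x₁ ∈ 𝒟) (fun a b c => by tauto),
      triT_congr (p := fun x₁ _ x₃ => x₁ ∈ 𝒟 ∧ x₃ ∈ A ∩ B) (q := fun x₁ _ x₃ => x₁ ∈ 𝒟 ∧ x₃ ∈ A ∧ x₃ ∈ B)
        (fun a b c => by simp only [Set.mem_inter_iff])] at h
    exact_mod_cast h
  have h1 : (0 : ℤ) ≤ triT τ (fun _ x₂ x₃ => x₂ ∈ A ∧ x₃ ∈ B ∧ x₃ ∈ 𝒟) := Nat.cast_nonneg _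
  have h2 : (0 : ℤ) ≤ triT τ (fun _ x₂ x₃ => x₂ ∈ A ∧ x₃ ∈ B ∧ x₂ ∈ 𝒟) := Nat.cast_nonneg _
  linarith

/-! ## Junta families and the BASE inequality on signatures -/

omit [Fintype ι] in
/-- The JUNTA LIFT of a family `𝔄` of subsets (of `Q`): `{x : x ∩ Q ∈ 𝔄}`. [this work] -/
def liftQ (Q : Set ι) (𝔄 : Set (Set ι)) : Set (Set ι) := {x | x ∩ Q ∈ 𝔄}

omit [Fintype ι] in
/-- Membership in a junta lift. [this work] -/
@[simp] theorem mem_liftQ {Q : Set ι} {𝔄 : Set (Set ι)} {x : Set ι} : x ∈ liftQ Q 𝔄 ↔ x ∩ Q ∈ 𝔄 := Iff.rfl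

omit [Fintype ι] in
/-- The junta lift of an up-set is an up-set. [this work] -/
theorem isUpperSet_liftQ (Q : Set ι) {𝔄 : Set (Set ι)} (h𝔄 : IsUpperSet 𝔄) : IsUpperSet (liftQ Q 𝔄) :=
  fun _ _ hxy hx => h𝔄 (Set.inter_subset_inter_left Q hxy) hx

omit [Fintype ι] in
/-- If `∅ ∈ 𝔄` (an up-set) the lift is everything. [this work] -/
theorem liftQ_eq_univ {Q : Set ι} {𝔄 : Set (Set ι)} (h𝔄 : IsUpperSet 𝔄) (h : (∅ : Set ι) ∈ 𝔄) : liftQ Q 𝔄 = Set.univ :=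
  Set.eq_univ_of_forall fun x => h𝔄 (Set.empty_subset (x ∩ Q)) h

/-- The number of representatives `#{(S₁,S₂,S₃) : x₁ ∩ Q = Q \ τ}`. [this work] -/
def nRep (τ Q : Set ι) : ℤ := triT τ (fun x₁ _ _ => x₁ ∩ Q = Q \ τ)

/-- There is a representative (`S₁ = Q`, `S₂ = ∅`). [this work] -/
theorem nRep_pos (τ Q : Set ι) : 0 < nRep τ Q := by
  unfold nRep
  rw [triT_eq_sum_indZ]
  have hw : indZ (Disjoint (Q, (∅ : Set ι)).1 (Q, (∅ : Set ι)).2 ∧ ((Q, (∅ : Set ι)).1 ∆ τ) ∩ Q = Q \ τ) = 1 := by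
    refine indZ_of_pos ⟨disjoint_bot_right, ?_⟩
    ext c; simp only [Set.mem_inter_iff, Set.mem_symmDiff, Set.mem_sdiff]; tauto
  have h := single_le_sum (f := fun q : Set ι × Set ι => indZ (Disjoint q.1 q.2 ∧ (q.1 ∆ τ) ∩ Q = Q \ τ))
    (fun q _ => indZ_nonneg _) (mem_univ (Q, (∅ : Set ι)))
  rw [hw] at h
  exact h

section Junta

variable (τ Q : Set ι) {𝔄 𝔅 : Set (Set ι)}

/-- `teeRep` for junta lifts: the Q-parts decide membership, the count is `nRep`. [this work] -/
theorem teeRep_liftQ (𝔄 𝔅 : Set (Set ι)) {m₂ m₃ : Set ι} (h₂ : m₂ ⊆ Q) (h₃ : m₃ ⊆ Q) :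
    teeRep τ Q (liftQ Q 𝔄) (liftQ Q 𝔅) m₂ m₃ = indZ (m₂ ∈ 𝔄 ∧ m₃ ∈ 𝔅) * nRep τ Q := by
  unfold teeRep nRep
  rw [← triT_and_const]
  exact_mod_cast triT_congr fun a b c => by rw [mem_liftQ, mem_liftQ, sdiff_union_inter_eq h₂, sdiff_union_inter_eq h₃]

/-- `deeRep` for junta lifts. [this work] -/
theorem deeRep_liftQ (𝔄 𝔅 : Set (Set ι)) {m : Set ι} (hm : m ⊆ Q) :
    deeRep τ Q (liftQ Q 𝔄) (liftQ Q 𝔅) m = indZ (m ∈ 𝔄 ∧ m ∈ 𝔅) * nRep τ Q := by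
  unfold deeRep nRep
  rw [← triT_and_const]
  exact_mod_cast triT_congr fun a b c => by rw [mem_liftQ, mem_liftQ, sdiff_union_inter_eq hm]

/-- **The theorem for junta families, from the nested class**: `N_τ(orFam Q; liftQ 𝔄, liftQ 𝔅) ≥ 0`. [this work] -/
theorem threePartNT_orFam_liftQ_nonneg (h𝔄 : IsUpperSet 𝔄) (h𝔅 : IsUpperSet 𝔅) :
    0 ≤ threePartNT τ (orFam Q) (liftQ Q 𝔄) (liftQ Q 𝔅) := by
  by_cases hE : (∅ : Set ι) ∈ 𝔄 ∧ (∅ : Set ι) ∈ 𝔅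
  · rw [liftQ_eq_univ h𝔄 hE.1, liftQ_eq_univ h𝔅 hE.2]
    exact threePartNT_nonneg_of_subset τ (isUpperSet_orFam Q) isUpperSet_univ isUpperSet_univ subset_rfl
  · have hd : ∀ x ∈ (orFam Q)ᶜ, ¬ (x ∈ liftQ Q 𝔄 ∧ x ∈ liftQ Q 𝔅) := by
      intro x hx h
      rw [Set.mem_compl_iff, mem_orFam, Set.not_nonempty_iff_eq_empty] at hx
      rw [mem_liftQ, mem_liftQ, hx] at h
      exact hE h
    have h1 := threePartNT_univ_eq_add_compl τ (orFam Q) (liftQ Q 𝔄) (liftQ Q 𝔅)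
    have h2 := threePartNT_nonpos_of_missing τ (orFam Q)ᶜ (isUpperSet_liftQ Q h𝔄) (isUpperSet_liftQ Q h𝔅) hd
    have h3 := threePartNT_nonneg_of_nested τ isUpperSet_univ (isUpperSet_liftQ Q h𝔄) (isUpperSet_liftQ Q h𝔅)
      (Or.inr (Or.inr (Or.inr (Or.inl (Set.subset_univ _)))))
    linarith

/-- **`Φ = Σ_P (2[qc₃P ≠ ∅] − [qc₁P ≠ ∅])·deeRep(qc₃ P)`** (any twist). [this work] -/
theorem phiPart_eq_sum_qc (A B : Set (Set ι)) : phiPart τ (orFam Q) A B =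
    ∑ P ∈ cfgsIn Q, (2 * indZ (qc₃ τ Q P).Nonempty - indZ (qc₁ τ Q P).Nonempty) * deeRep τ Q A B (qc₃ τ Q P) := by
  unfold phiPart
  rw [triT_eq_sum_cfgsIn τ Q (fun _ _ x₃ => x₃ ∈ orFam Q ∧ x₃ ∈ A ∧ x₃ ∈ B),
    triT_eq_sum_cfgsIn τ Q (fun x₁ _ x₃ => x₁ ∈ orFam Q ∧ x₃ ∈ A ∧ x₃ ∈ B)]
  push_cast
  rw [mul_sum, ← sum_sub_distrib]
  refine sum_congr rfl fun P hP => ?_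
  rw [mem_cfgsIn] at hP
  have f3 : (triT τ (fun x₁ x₂ x₃ => x₁ ∩ Q = Q \ τ ∧ (x₃ \ Q ∪ qc₃ τ Q P ∈ orFam Q ∧ x₃ \ Q ∪ qc₃ τ Q P ∈ A ∧ x₃ \ Q ∪ qc₃ τ Q P ∈ B)) : ℤ)
      = indZ (qc₃ τ Q P).Nonempty * deeRep τ Q A B (qc₃ τ Q P) := by
    unfold deeRep; rw [← triT_and_const]; exact_mod_cast triT_congr fun a b d => by
      rw [sdiff_union_mem_orFam_iff (x := d) (qc₃_subset τ Q P)]; tauto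
  have f1 : (triT τ (fun x₁ x₂ x₃ => x₁ ∩ Q = Q \ τ ∧ (x₁ \ Q ∪ qc₁ τ Q P ∈ orFam Q ∧ x₃ \ Q ∪ qc₃ τ Q P ∈ A ∧ x₃ \ Q ∪ qc₃ τ Q P ∈ B)) : ℤ)
      = indZ (qc₁ τ Q P).Nonempty * deeRep τ Q A B (qc₃ τ Q P) := by
    unfold deeRep; rw [← triT_and_const]; exact_mod_cast triT_congr fun a b d => by
      rw [sdiff_union_mem_orFam_iff (x := a) (qc₁_subset (τ := τ) hP.1)]; tauto
  rw [f3, f1]; ring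

/-- **(BASE)** the pointwise inequality on signatures `𝔄, 𝔅 ⊆ 2^Q` (any up-sets of `Set ι`), any twist:
`Σ_P c(P)·[qc₂P ∈ 𝔄][qc₃P ∈ 𝔅] ≤ Σ_P (2[qc₃P ≠ ∅] − [qc₁P ≠ ∅])·[qc₃P ∈ 𝔄 ∩ 𝔅]` — the junta case of the theorem, divided by `nRep > 0`.
[this work] -/
theorem base_ineq (h𝔄 : IsUpperSet 𝔄) (h𝔅 : IsUpperSet 𝔅) :
    ∑ P ∈ cfgsIn Q, cPat τ Q P * indZ (qc₂ τ Q P ∈ 𝔄 ∧ qc₃ τ Q P ∈ 𝔅) ≤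
      ∑ P ∈ cfgsIn Q, (2 * indZ (qc₃ τ Q P).Nonempty - indZ (qc₁ τ Q P).Nonempty) * indZ (qc₃ τ Q P ∈ 𝔄 ∧ qc₃ τ Q P ∈ 𝔅) := by
  have hN := threePartNT_orFam_liftQ_nonneg τ Q h𝔄 h𝔅
  have hR : rPart τ (orFam Q) (liftQ Q 𝔄) (liftQ Q 𝔅) = nRep τ Q * ∑ P ∈ cfgsIn Q, cPat τ Q P * indZ (qc₂ τ Q P ∈ 𝔄 ∧ qc₃ τ Q P ∈ 𝔅) := by
    rw [rPart_eq_sum_cPat, mul_sum]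
    refine sum_congr rfl fun P hP => ?_
    rw [mem_cfgsIn] at hP
    rw [teeRep_liftQ τ Q 𝔄 𝔅 (qc₂_subset (τ := τ) hP.2.1) (qc₃_subset τ Q P)]; ring
  have hΦ : phiPart τ (orFam Q) (liftQ Q 𝔄) (liftQ Q 𝔅) =
      nRep τ Q * ∑ P ∈ cfgsIn Q, (2 * indZ (qc₃ τ Q P).Nonempty - indZ (qc₁ τ Q P).Nonempty) * indZ (qc₃ τ Q P ∈ 𝔄 ∧ qc₃ τ Q P ∈ 𝔅) := by
    rw [phiPart_eq_sum_qc, mul_sum]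
    refine sum_congr rfl fun P _ => ?_
    rw [deeRep_liftQ τ Q 𝔄 𝔅 (qc₃_subset τ Q P)]; ring
  rw [threePartNT_eq_phiPart_sub_rPart, hΦ, hR, ← mul_sub] at hN
  exact sub_nonneg.1 ((mul_nonneg_iff_of_pos_left (nRep_pos τ Q)).1 hN)

end Junta

/-! ## The chain in the case `τ ∩ Q ≠ ∅` -/

section ChainI

variable (τ Q : Set ι) (A B : Set (Set ι))

/-- The representative `dee`-count with DIFFERENT Q-parts `m₂` (tested against `A`) and `m₃` (against `B`) on copy 3. [this work] -/
def deeRep₂ (m₂ m₃ : Set ι) : ℤ := triT τ (fun x₁ _ x₃ => x₁ ∩ Q = Q \ τ ∧ (x₃ \ Q ∪ m₂ ∈ A ∧ x₃ \ Q ∪ m₃ ∈ B))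

/-- `deeRep₂` as a weighted sum over pairs. [this work] -/
theorem deeRep₂_eq_sum (m₂ m₃ : Set ι) :
    deeRep₂ τ Q A B m₂ m₃ = ∑ q : Set ι × Set ι, repInd τ Q q * indZ (tr₃ τ Q q ∪ m₂ ∈ A ∧ tr₃ τ Q q ∪ m₃ ∈ B) := by
  unfold deeRep₂ tr₃; rw [triT_rep_eq_sum τ Q (fun _ x₃ => x₃ \ Q ∪ m₂ ∈ A ∧ x₃ \ Q ∪ m₃ ∈ B)]

/-- KLEITMAN STEP with different Q-parts: `teeRep m₂ m₃ ≤ deeRep₂ m₂ m₃`. [this work] -/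
theorem teeRep_le_deeRep₂ {A B : Set (Set ι)} (hA : IsUpperSet A) (hB : IsUpperSet B) (m₂ m₃ : Set ι) :
    teeRep τ Q A B m₂ m₃ ≤ deeRep₂ τ Q A B m₂ m₃ := by
  have h := teeT_le_deeT τ (repU τ Q) (isUpperSet_shiftQ Q hA m₂) (isUpperSet_shiftQ Q hB m₃)
  have e1 : teeT τ (repU τ Q) (shiftQ Q A m₂) (shiftQ Q B m₃) =
      triT τ (fun x₁ x₂ x₃ => x₁ ∩ Q = Q \ τ ∧ (x₂ \ Q ∪ m₂ ∈ A ∧ x₃ \ Q ∪ m₃ ∈ B)) := by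
    unfold teeT; exact triT_congr fun x₁ x₂ x₃ => by simp only [repU, shiftQ, Set.mem_setOf_eq]
  have e2 : deeT τ (repU τ Q) (shiftQ Q A m₂ ∩ shiftQ Q B m₃) =
      triT τ (fun x₁ _ x₃ => x₁ ∩ Q = Q \ τ ∧ (x₃ \ Q ∪ m₂ ∈ A ∧ x₃ \ Q ∪ m₃ ∈ B)) := by
    unfold deeT; exact triT_congr fun x₁ x₂ x₃ => by simp only [repU, shiftQ, Set.mem_setOf_eq, Set.mem_inter_iff]
  unfold teeRep deeRep₂
  rw [← e1, ← e2]; exact_mod_cast h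

omit [Fintype ι] in
/-- **`c(P) ≥ 0` when `τ` meets `Q`**: an element of `τ ∩ Q` lies in exactly one part, hence in the other two TWISTED parts, so
`[qc₂ ≠ ∅] + [qc₃ ≠ ∅] ≥ 1 ≥ [qc₁ ≠ ∅]`. [this work] -/
theorem cPat_nonneg {τ Q : Set ι} (hτ : (τ ∩ Q).Nonempty) (P : Set ι × Set ι) : 0 ≤ cPat τ Q P := by
  obtain ⟨t, htτ, htQ⟩ := hτ
  unfold cPat
  have h3 : t ∈ P.2 → t ∈ qc₃ τ Q P := fun h => (mem_qc₃_iff τ Q P t).2 (Or.inr ⟨⟨htτ, htQ⟩, fun hh => hh.2 (Or.inr h)⟩)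
  have h2 : t ∉ P.2 → t ∈ qc₂ τ Q P := fun h => (mem_qc₂_iff τ Q P t).2 (Or.inr ⟨⟨htτ, htQ⟩, h⟩)
  have hab : 1 ≤ indZ (qc₂ τ Q P).Nonempty + indZ (qc₃ τ Q P).Nonempty := by
    by_cases ht : t ∈ P.2
    · rw [indZ_of_pos (p := (qc₃ τ Q P).Nonempty) ⟨t, h3 ht⟩]; linarith [indZ_nonneg (qc₂ τ Q P).Nonempty]
    · rw [indZ_of_pos (p := (qc₂ τ Q P).Nonempty) ⟨t, h2 ht⟩]; linarith [indZ_nonneg (qc₃ τ Q P).Nonempty]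
  linarith [indZ_le_one (qc₁ τ Q P).Nonempty]

/-- Exchange over patterns: `Σ_P w(P)·Σ_q ρ(q)g(q,P) = Σ_q ρ(q)·Σ_P w(P)g(q,P)`. [this work] -/
theorem sum_cfgsIn_mul_sum (w : Set ι × Set ι → ℤ) (g : (Set ι × Set ι) → (Set ι × Set ι) → ℤ) :
    ∑ P ∈ cfgsIn Q, w P * ∑ q : Set ι × Set ι, repInd τ Q q * g q P =
      ∑ q : Set ι × Set ι, repInd τ Q q * ∑ P ∈ cfgsIn Q, w P * g q P := by
  have h1 : ∀ P ∈ cfgsIn Q, w P * ∑ q : Set ι × Set ι, repInd τ Q q * g q P =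
      ∑ q : Set ι × Set ι, repInd τ Q q * (w P * g q P) := by
    intro P _; rw [mul_sum]; exact sum_congr rfl fun q _ => by ring
  rw [sum_congr rfl h1, sum_comm]
  exact sum_congr rfl fun q _ => by rw [mul_sum]

/-- **The chain for `τ ∩ Q ≠ ∅`**: `R ≤ Σ_P c(P)·deeRep₂ ≤ Φ` (Kleitman termwise with `c ≥ 0`, then (BASE) pointwise in the trace of copy 3).
[this work] -/
theorem rPart_le_phiPart_of_meets {τ Q : Set ι} (hτ : (τ ∩ Q).Nonempty) {A B : Set (Set ι)} (hA : IsUpperSet A) (hB : IsUpperSet B) :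
    rPart τ (orFam Q) A B ≤ phiPart τ (orFam Q) A B := by
  rw [rPart_eq_sum_cPat, phiPart_eq_sum_qc]
  calc ∑ P ∈ cfgsIn Q, cPat τ Q P * teeRep τ Q A B (qc₂ τ Q P) (qc₃ τ Q P)
      ≤ ∑ P ∈ cfgsIn Q, cPat τ Q P * deeRep₂ τ Q A B (qc₂ τ Q P) (qc₃ τ Q P) :=
        sum_le_sum fun P _ => mul_le_mul_of_nonneg_left (teeRep_le_deeRep₂ τ Q hA hB _ _) (cPat_nonneg hτ P)
    _ = ∑ q : Set ι × Set ι, repInd τ Q q * ∑ P ∈ cfgsIn Q, cPat τ Q P * indZ (tr₃ τ Q q ∪ qc₂ τ Q P ∈ A ∧ tr₃ τ Q q ∪ qc₃ τ Q P ∈ B) := by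
        rw [← sum_cfgsIn_mul_sum]
        exact sum_congr rfl fun P _ => by rw [deeRep₂_eq_sum]
    _ ≤ ∑ q : Set ι × Set ι, repInd τ Q q * ∑ P ∈ cfgsIn Q,
          (2 * indZ (qc₃ τ Q P).Nonempty - indZ (qc₁ τ Q P).Nonempty) * indZ (tr₃ τ Q q ∪ qc₃ τ Q P ∈ A ∧ tr₃ τ Q q ∪ qc₃ τ Q P ∈ B) :=
        sum_le_sum fun q _ => mul_le_mul_of_nonneg_left
          (base_ineq τ Q (isUpperSet_sig hA (tr₃ τ Q q)) (isUpperSet_sig hB (tr₃ τ Q q))) (repInd_nonneg τ Q q)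
    _ = ∑ P ∈ cfgsIn Q, (2 * indZ (qc₃ τ Q P).Nonempty - indZ (qc₁ τ Q P).Nonempty) * deeRep τ Q A B (qc₃ τ Q P) := by
        rw [← sum_cfgsIn_mul_sum]
        exact sum_congr rfl fun P _ => by rw [deeRep_eq_sum]

end ChainI

/-! ## The theorem -/

/-- **THE ONE-DISJUNCTION THEOREM**: for EVERY twist `τ`, every `Q`, and all up-sets `A, B`,
`threePartNT τ (orFam Q) A B ≥ 0` — twisted three-partition positivity (equivalently COMB-C3 at every profile) for one disjunction
`OR(Q) = {S : S ∩ Q ≠ ∅}` against two ARBITRARY increasing events. [this work] -/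
theorem threePartNT_orFam_nonneg (τ Q : Set ι) {A B : Set (Set ι)} (hA : IsUpperSet A) (hB : IsUpperSet B) :
    0 ≤ threePartNT τ (orFam Q) A B := by
  by_cases h : (τ ∩ Q).Nonempty
  · rw [threePartNT_eq_phiPart_sub_rPart, sub_nonneg]; exact rPart_le_phiPart_of_meets h hA hB
  · exact threePartNT_orFam_nonneg_of_disjoint (Set.not_nonempty_iff_eq_empty.1 h) hA hB

/-- The theorem in any slot. [this work] -/
theorem threePartNT_nonneg_of_or (τ : Set ι) {𝒰 𝒱 𝒲 : Set (Set ι)} (h𝒰 : IsUpperSet 𝒰) (h𝒱 : IsUpperSet 𝒱) (h𝒲 : IsUpperSet 𝒲)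
    (h : (∃ Q : Set ι, 𝒰 = orFam Q) ∨ (∃ Q : Set ι, 𝒱 = orFam Q) ∨ (∃ Q : Set ι, 𝒲 = orFam Q)) :
    0 ≤ threePartNT τ 𝒰 𝒱 𝒲 := by
  rcases h with ⟨Q, rfl⟩ | ⟨Q, rfl⟩ | ⟨Q, rfl⟩
  · exact threePartNT_orFam_nonneg τ Q h𝒱 h𝒲
  · rw [threePartNT_swap12]; exact threePartNT_orFam_nonneg τ Q h𝒰 h𝒲
  · rw [threePartNT_swap23, threePartNT_swap12]; exact threePartNT_orFam_nonneg τ Q h𝒰 h𝒱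

/-- `⊤` or a disjunction in the third slot (the sections of a disjunction are of this form), arbitrary up-sets elsewhere. [this work] -/
theorem threePartNT_nonneg_of_univ_or_or₃ (τ : Set ι) {𝒰 𝒱 𝒲 : Set (Set ι)} (h𝒰 : IsUpperSet 𝒰) (h𝒱 : IsUpperSet 𝒱)
    (h𝒲 : 𝒲 = Set.univ ∨ ∃ Q : Set ι, 𝒲 = orFam Q) : 0 ≤ threePartNT τ 𝒰 𝒱 𝒲 := by
  rcases h𝒲 with rfl | ⟨Q, rfl⟩
  · exact threePartNT_nonneg_of_nested τ h𝒰 h𝒱 isUpperSet_univ (Or.inr (Or.inr (Or.inl (Set.subset_univ _))))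
  · exact threePartNT_nonneg_of_or τ h𝒰 h𝒱 (isUpperSet_orFam Q) (Or.inr (Or.inr ⟨Q, rfl⟩))

end Summit.CriticalPhenomena.PercolationContinuityZ3.Theorems.ThreePartition

end
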